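import Literature.AlgebraicGeometry.HodgeTheory.FermatEigenspaceHodgeDecomposition
import Literature.AlgebraicGeometry.HodgeTheory.CanonicalDegreeHypersurfaceResidueForm
import Literature.AlgebraicGeometry.HodgeTheory.HolomorphicTopFormClassesBijective
import Literature.AlgebraicGeometry.HodgeTheory.HypersurfaceComplexPoints
import Literature.AlgebraicGeometry.HodgeTheory.HodgeModelConnected
import Literature.AlgebraicGeometry.Motives.GeneralNonsingularForms
import HarnessLib

/-!
# `H^{n,0}` of a smooth hypersurface of degree `n + 2` is the character `det` of its diagonal symmetries

Family `hodge`, layer `Literature/AlgebraicGeometry/HodgeTheory`. PROOF FILE (theorems only; no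
definition, no named fact — D-0026). Let `F ∈ ℂ[X₀, …, X_{n+1}]` be a NONSINGULAR form of degree
`n + 2` (`SmoothHypersurface.IsNonsingularForm`, with `X_F = V₊(F)` smooth projective of dimension
`n`: a Calabi–Yau hypersurface — plane cubic, quartic surface, quintic threefold, sextic fourfold),
`G ≤ diagonalStabilizer F` a group of diagonal symmetries `g_a : [z] ↦ [a • z]` of `X_F`, and
`V_χ ⊆ Hⁿ(X_F(ℂ); ℂ)` the eigenspace of a character `χ : G → ℂˣ` (`diagonalCharacterEigenspace`).

* `hypersurface_eigenform_top_eq_zero_of_ne_prod` — on (the carrier of) a Hodge model `A` of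
  `X_F`, a smooth closed `(n,0)`-form `η` with `(g_a^an)^* η = t • η` and `t ≠ ∏ᵢ aᵢ` vanishes.
  Mechanism (all in the tree): `η` is holomorphic in charts
  (`isHolomorphicInCharts_of_isClosedForm_of_isOfType_top`), the carrier is a compact connected
  complex `n`-fold embedded onto `V(F) ⊂ ℙ(ℂⁿ⁺²)` with holomorphic affine coordinates
  (`hypersurface_complexPoints`, GAGA), on which Griffiths' residue `Res(Ω/F)` is a nowhere-vanishing
  holomorphic `n`-form with `(g_a^an)^* Res = (∏ aᵢ) Res`, so `η = c · Res` transforms by `∏ aᵢ`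
  (`CanonicalDegreeHypersurfaceResidueForm`: `eq_zero_of_pullback_eq_smul_of_ne`).
* `hypersurface_eigenspace_hodgePQ_top_zero_eq_zero_of_ne_prod` — **if `χ(a) ≠ ∏ᵢ aᵢ` for some
  `a ∈ G`, then `V_χ ∩ H^{n,0}(X_F) = 0`**: every `x ∈ V_χ` whose pull-back to a Hodge model is of
  type `(n,0)` is zero (`eigenspace_hodgePQ_top_zero_eq_zero_of_eigenforms` fed with the previous
  item); `…_isOfHodgeType_…` — the same with the model-free `IsOfHodgeType n X_F n n 0`.
* `hypersurface_finrank_hodgePQ_top_zero_eq_one` — **`h^{n,0}(X_F) = 1`** (`p_g = 1`): `H^{n,0}_A ≅ Ω^n(X^an)`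
  (`topHolFormClassPQ_bijective`) `= ℂ · Res(Ω/F)` (`holFormsInCharts_eq_span_singleton`).

In print: `H^{n,0}(X_F) = H⁰(X_F, K) = ℂ · Res(Ω/F)` (`K_{X_F} = 𝒪(d - n - 2) = 𝒪`, Hartshorne II
Ex. 8.20.3; Voisin II, Cor. 6.12 at `p = 1`: `R_F⁰ = ℂ ≅ H^{n,0}`), and `g^* Res(Ω/F) = det(g) Res(Ω/F)`
for a linear symmetry `g` of `F` (Voisin II, §6.1.3); for the Fermat variety `Xⁿₘ`, `m = n + 2`,
this is Shioda's (1.7): `V(α) ⊂ H^{n,0}` iff `α = (1, …, 1)`; for the Dwork pencil Katz 2009, §3 /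
Lemma 3.1 (`∏ aᵢ = 1` on `Γ_W`, so `H^{n,0}` is `Γ_W`-invariant — file `DworkSexticTopCharacter`).

## References

* [VoisinHodgeII2003] C. Voisin, Hodge Theory and Complex Algebraic Geometry II (2003), §6.1.3,
  Thm. 6.10, Cor. 6.12.
* [Shioda1979HodgeFermat] T. Shioda, The Hodge conjecture for Fermat varieties, Math. Ann. 245
  (1979), §1 (1.7).
* [Katz2009] N. M. Katz, Another look at the Dwork family, Progr. Math. 270 (2009), §3, Lemma 3.1.
* [SerreGAGA1956] J.-P. Serre, GAGA, Ann. Inst. Fourier 6 (1956), §2 n°5.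
* [Hartshorne1977] R. Hartshorne, Algebraic Geometry (1977), II Example 8.20.3.
-/

noncomputable section

open scoped Manifold ContDiff Topology LinearAlgebra.Projectivization
open CategoryTheory AlgebraicGeometry

namespace Literature.AlgebraicGeometry.HodgeTheory

open Literature.AlgebraicGeometry.Motives Literature.AlgebraicTopology.SingularHomology
  Literature.NumberTheory.Transcendental Literature.Geometry.Kaehler

variable {n : ℕ} {F : MvPolynomial (Fin (n + 2)) ℂ} {G : Subgroup (Fin (n + 2) → ℂˣ)}

/-- **Eigenforms of top degree on a Calabi–Yau hypersurface have eigenvalue `det`.** Let `F` be a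
nonsingular form of degree `n + 2` with `X_F` smooth projective of dimension `n`, `A` a Hodge model of
`X_F`, `a ∈ diagonalStabilizer F`, and `η` a smooth closed `n`-form of type `(n,0)` on `A.carrier` with
`(g_a^an)^* η = t • η`, `g_a^an = HodgeModel.anMap A A (diagonalAut F ha)`. If `t ≠ ∏ᵢ aᵢ` then
`η = 0`. Proof: read `A.carrier` as a compact connected holomorphic model of `V(F)`
(`hypersurface_complexPoints`, `IsAnalytification.mdifferentiableOn_evalOrZero`,
`HodgeModel.compactSpace_carrier`, `HodgeModel.connectedSpace_carrier`) with the holomorphic symmetry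
`g_a^an` over `[z] ↦ [a • z]` (`HodgeModel.mdifferentiable_anMap`, `hypersurfacePoint_diagonalMap`);
`η` is holomorphic in charts (`isHolomorphicInCharts_of_isClosedForm_of_isOfType_top`), hence a
constant multiple of the nowhere-vanishing `Res(Ω/F)`, which transforms by `∏ᵢ aᵢ`
(`eq_zero_of_pullback_eq_smul_of_ne`). In print: `H⁰(X_F, K) = ℂ · Res(Ω/F)` and
`g^* Res(Ω/F) = det(g) Res(Ω/F)`. [cite: VoisinHodgeII2003, §6.1.3 and Cor. 6.12 (p = 1)]
[cite: Shioda1979HodgeFermat, §1 (1.7)] [cite: SerreGAGA1956, §2 n°5] -/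
theorem hypersurface_eigenform_top_eq_zero_of_ne_prod (hF : F.IsHomogeneous (n + 2))
    (hJ : SmoothHypersurface.IsNonsingularForm ℂ F)
    (hX : IsSmoothProjective n (SmoothHypersurface.hypersurface F))
    (A : HodgeModel n (SmoothHypersurface.hypersurface F)) {a : Fin (n + 2) → ℂˣ}
    (ha : a ∈ diagonalStabilizer F) {η : MForm 𝓘(ℝ, A.model) A.carrier ℂ n}
    (hs : IsSmoothForm η) (hc : IsClosedForm η) (ht : IsOfType n 0 η) {t : ℂ}
    (heig : η.pullback 𝓘(ℝ, A.model) (HodgeModel.anMap A A (diagonalAut F ha)) = t • η)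
    (hne : t ≠ ∏ i, ((a i : ℂ))) : η = 0 := by
  -- the concrete model `(A.carrier, ψ, Φ)`
  obtain ⟨hemb, hrangeψ, hcoord⟩ := hypersurface_complexPoints
    (SmoothHypersurface.hypersurfaceι F) hF (SmoothHypersurface.range_hypersurfaceι F)
  haveI : CompactSpace A.carrier := A.compactSpace_carrier hX
  haveI : ConnectedSpace A.carrier := A.connectedSpace_carrier hX
  set ψ : A.carrier → ℙ ℂ (Fin (n + 2) → ℂ) :=
    hypersurfacePoint (SmoothHypersurface.hypersurfaceι F) ∘ A.toComplexPoints with hψ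
  have hψemb : Topology.IsEmbedding ψ :=
    hemb.comp A.isAnalytification.homeomorph.isEmbedding
  have hψrange : Set.range ψ = Projectivization.projZeroLocus {F} := by
    rw [hψ, Set.range_comp, A.isAnalytification.isHomeomorph.surjective.range_eq, Set.image_univ,
      hrangeψ]
  -- the affine coordinates of `ψ` are holomorphic (regular functions pull back to holomorphic ones)
  have hhol : HasHolomorphicCoords A.model ψ := by
    intro i j
    obtain ⟨U, hU, hsU⟩ := hcoord i
    obtain ⟨s, hs'⟩ := hsU j
    have hhol := A.isAnalytification.mdifferentiableOn_evalOrZero U s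
    have hset : ψ ⁻¹' (Projectivization.stdChart i).source =
        A.toComplexPoints ⁻¹' {P | P.pt ∈ (↑U : (SmoothHypersurface.hypersurface F).left.Opens)} := by
      rw [hU, hψ, Set.preimage_comp]
    change MDifferentiableOn 𝓘(ℂ, A.model) 𝓘(ℂ, ℂ) _ (ψ ⁻¹' (Projectivization.stdChart i).source)
    rw [hset]
    exact hhol.congr fun x hx ↦ (hs' (A.toComplexPoints x) hx).symm
  -- the Jacobian condition
  have hjac : ∀ z : Fin (n + 2) → ℂ, z ≠ 0 → MvPolynomial.eval z F = 0 →
      ∃ j, MvPolynomial.eval z (MvPolynomial.pderiv j F) ≠ 0 :=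
    fun z hz hFz ↦ hJ.exists_eval_pderiv_ne_zero hz hFz
  -- the holomorphic self-map `g_a^an` over `[z] ↦ [a • z]`
  set Φ : A.carrier → A.carrier := HodgeModel.anMap A A (diagonalAut F ha) with hΦ
  have hΦd : MDifferentiable 𝓘(ℂ, A.model) 𝓘(ℂ, A.model) Φ :=
    HodgeModel.mdifferentiable_anMap A A _ hX hX
  have hΦψ : ∀ x : A.carrier, ψ (Φ x) =
      Projectivization.mk ℂ (a • (ψ x).rep)
        ((smul_ne_zero_iff_ne a).mpr (Projectivization.rep_nonzero _)) := by
    intro x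
    simp only [hψ, hΦ, Function.comp_apply, HodgeModel.toComplexPoints_anMap]
    rw [← diagonalMap_apply]
    exact hypersurfacePoint_diagonalMap F _ _
  -- `η` is holomorphic in charts, hence `c • Res(Ω/F)`, which transforms by `∏ aᵢ`
  have hη : IsHolomorphicInCharts η :=
    isHolomorphicInCharts_of_isClosedForm_of_isOfType_top A.finrank_model hs hc ht
  exact eq_zero_of_pullback_eq_smul_of_ne hΦψ hF hψemb hψrange.le hjac hhol A.finrank_model hΦd
    (eval_smul_of_mem_diagonalStabilizer ha) hη heig hne

/-- **`V_χ ∩ H^{n,0}(X_F) = 0` for a character `χ ≠ det` of a group of diagonal symmetries of a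
Calabi–Yau hypersurface.** Let `F` be a nonsingular form of degree `n + 2` with `X_F` smooth
projective of dimension `n`, `G ≤ diagonalStabilizer F`, `χ : G → ℂˣ` with `χ(a) ≠ ∏ᵢ aᵢ` for some
`a ∈ G`, and `A` a Hodge model of `X_F`. Then every `x ∈ V_χ ⊆ Hⁿ(X_F(ℂ); ℂ)` with `A^* x ∈ H^{n,0}_A`
is zero: `A^* x` is the class of a `χ`-eigen closed `(n,0)`-form
(`eigenspace_hodgePQ_top_zero_eq_zero_of_eigenforms`), which vanishes by
`hypersurface_eigenform_top_eq_zero_of_ne_prod`. In print: `H^{n,0}(X_F) = ℂ · Res(Ω/F)` carries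
the character `det` (Shioda (1.7): `H^{n,0}(Xⁿₘ) ∩ V(α) ≠ 0` only for `α = (1, …, 1)`; Katz 2009,
Lemma 3.1 for the Dwork family). [cite: Shioda1979HodgeFermat, §1 (1.7)]
[cite: Katz2009, §3 and Lemma 3.1] [cite: VoisinHodgeII2003, §6.1.3 and Cor. 6.12 (p = 1)] -/
theorem hypersurface_eigenspace_hodgePQ_top_zero_eq_zero_of_ne_prod (hF : F.IsHomogeneous (n + 2))
    (hJ : SmoothHypersurface.IsNonsingularForm ℂ F)
    (hX : IsSmoothProjective n (SmoothHypersurface.hypersurface F))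
    (hG : G ≤ diagonalStabilizer F) (χ : G →* ℂˣ)
    (hχ : ∃ a : G, ((χ a : ℂˣ) : ℂ) ≠ ∏ i, (((a : Fin (n + 2) → ℂˣ) i : ℂˣ) : ℂ))
    (A : HodgeModel n (SmoothHypersurface.hypersurface F))
    {x : complexBetti (SmoothHypersurface.hypersurface F) n}
    (hx : x ∈ diagonalCharacterEigenspace F G χ n) (hxA : A.pullback n x ∈ A.hodgePQ n n 0) :
    x = 0 := by
  obtain ⟨a, ha⟩ := hχ
  refine eigenspace_hodgePQ_top_zero_eq_zero_of_eigenforms F hG χ hX A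
    (fun η hs hc ht heig ↦ ?_) hx hxA
  exact hypersurface_eigenform_top_eq_zero_of_ne_prod hF hJ hX A (hG a.2) hs hc ht (heig a) ha

/-- The same with the model-free Hodge type: for `χ(a) ≠ ∏ᵢ aᵢ` some `a ∈ G`, every `x ∈ V_χ` of
Hodge type `(n,0)` (`IsOfHodgeType`, any model computes it: `isOfHodgeType_iff_mem_hodgePQ`) is
zero. [cite: Shioda1979HodgeFermat, §1 (1.7)] [cite: Katz2009, §3 and Lemma 3.1] -/
theorem hypersurface_eigenspace_isOfHodgeType_top_zero_eq_zero_of_ne_prod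
    (hF : F.IsHomogeneous (n + 2)) (hJ : SmoothHypersurface.IsNonsingularForm ℂ F)
    (hX : IsSmoothProjective n (SmoothHypersurface.hypersurface F))
    (hG : G ≤ diagonalStabilizer F) (χ : G →* ℂˣ)
    (hχ : ∃ a : G, ((χ a : ℂˣ) : ℂ) ≠ ∏ i, (((a : Fin (n + 2) → ℂˣ) i : ℂˣ) : ℂ))
    {x : complexBetti (SmoothHypersurface.hypersurface F) n}
    (hx : x ∈ diagonalCharacterEigenspace F G χ n)
    (hxT : IsOfHodgeType n (SmoothHypersurface.hypersurface F) n n 0 x) : x = 0 := by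
  obtain ⟨A, hxA⟩ := hxT
  exact hypersurface_eigenspace_hodgePQ_top_zero_eq_zero_of_ne_prod hF hJ hX hG χ hχ A hx hxA

/-! ### `p_g = 1`: `H^{n,0}` of a smooth hypersurface of degree `n + 2` is a line -/

/-- **`h^{n,0}(X_F) = 1` for a smooth hypersurface of degree `n + 2`** (appended 2026-08-27, prover
seat `hodge-nonav-20241-p1` g4). For a nonsingular form `F` of degree `n + 2` with `X_F` smooth
projective of dimension `n`, and every Hodge model `A` of `X_F`, `dim_ℂ H^{n,0}_A = 1`: the class map
`Ω^n(X_F^an) → H^{n,0}_A` is a linear bijection (`HodgeModel.topHolFormClassPQ_bijective`, Voisin I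
Cor. 7.6), and `Ω^n(X_F^an) = ℂ · Res(Ω/F)` (`holFormsInCharts_eq_span_singleton` with the
nowhere-vanishing residue form, `residueForm_one_ne_zero`, `isHolomorphicInCharts_residueForm_one`; the
carrier is compact, connected and non-empty). In print: `ω_{X_F} ≅ 𝒪(d - n - 2) = 𝒪`, so
`p_g(X_F) = h⁰(𝒪) = 1` (Hartshorne II Ex. 8.20.3; Voisin II Cor. 6.12 at `p = 1`: `R_F⁰ = ℂ ≅ H^{n,0}`)
— the plane cubic, the quartic (K3) surface, the quintic threefold, the sextic fourfold.
[cite: VoisinHodgeII2003, §6.1.3 Cor. 6.12 (p = 1)] [cite: Hartshorne1977, II Example 8.20.3]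
[cite: VoisinHodgeI2002, §7.1.1 Cor. 7.6] -/
theorem hypersurface_finrank_hodgePQ_top_zero_eq_one (hF : F.IsHomogeneous (n + 2))
    (hJ : SmoothHypersurface.IsNonsingularForm ℂ F)
    (hX : IsSmoothProjective n (SmoothHypersurface.hypersurface F))
    (A : HodgeModel n (SmoothHypersurface.hypersurface F)) :
    Module.finrank ℂ ↥(A.hodgePQ n n 0) = 1 := by
  -- the concrete model `(A.carrier, ψ)`
  obtain ⟨hemb, hrangeψ, hcoord⟩ := hypersurface_complexPoints
    (SmoothHypersurface.hypersurfaceι F) hF (SmoothHypersurface.range_hypersurfaceι F)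
  haveI : CompactSpace A.carrier := A.compactSpace_carrier hX
  haveI : ConnectedSpace A.carrier := A.connectedSpace_carrier hX
  set ψ : A.carrier → ℙ ℂ (Fin (n + 2) → ℂ) :=
    hypersurfacePoint (SmoothHypersurface.hypersurfaceι F) ∘ A.toComplexPoints with hψ
  have hψemb : Topology.IsEmbedding ψ :=
    hemb.comp A.isAnalytification.homeomorph.isEmbedding
  have hψrange : Set.range ψ = Projectivization.projZeroLocus {F} := by
    rw [hψ, Set.range_comp, A.isAnalytification.isHomeomorph.surjective.range_eq, Set.image_univ,
      hrangeψ]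
  have hhol : HasHolomorphicCoords A.model ψ := by
    intro i j
    obtain ⟨U, hU, hsU⟩ := hcoord i
    obtain ⟨s, hs'⟩ := hsU j
    have hhol := A.isAnalytification.mdifferentiableOn_evalOrZero U s
    have hset : ψ ⁻¹' (Projectivization.stdChart i).source =
        A.toComplexPoints ⁻¹' {P | P.pt ∈ (↑U : (SmoothHypersurface.hypersurface F).left.Opens)} := by
      rw [hU, hψ, Set.preimage_comp]
    change MDifferentiableOn 𝓘(ℂ, A.model) 𝓘(ℂ, ℂ) _ (ψ ⁻¹' (Projectivization.stdChart i).source)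
    rw [hset]
    exact hhol.congr fun x hx ↦ (hs' (A.toComplexPoints x) hx).symm
  have hjac : ∀ z : Fin (n + 2) → ℂ, z ≠ 0 → MvPolynomial.eval z F = 0 →
      ∃ j, MvPolynomial.eval z (MvPolynomial.pderiv j F) ≠ 0 :=
    fun z hz hFz ↦ hJ.exists_eval_pderiv_ne_zero hz hFz
  -- `Ω^n(X^an) = ℂ · Res(Ω/F)`, `Res(Ω/F) ≠ 0`
  have hΩ : IsHolomorphicInCharts (residueForm (E := A.model) ψ F 1) :=
    isHolomorphicInCharts_residueForm_one hF hψemb.continuous hψrange.le hjac hhol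
  have hΩ0 : ∀ x, residueForm (E := A.model) ψ F 1 x ≠ 0 :=
    residueForm_one_ne_zero hF hψemb hψrange.le hjac hhol A.finrank_model
  have hspan := holFormsInCharts_eq_span_singleton (M := A.carrier) A.finrank_model hΩ hΩ0
  obtain ⟨x₀⟩ := A.nonempty_carrier hX
  have hne : residueForm (E := A.model) ψ F 1 ≠ 0 := fun h ↦ hΩ0 x₀ (by rw [h]; rfl)
  have h1 : Module.finrank ℂ ↥(holFormsInCharts A.model A.carrier n) = 1 := by
    rw [hspan]
    exact finrank_span_singleton hne
  rw [← (LinearEquiv.ofBijective A.topHolFormClassPQ (A.topHolFormClassPQ_bijective hX)).finrank_eq, h1]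

end Literature.AlgebraicGeometry.HodgeTheory

end
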